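import Mathlib
import Literature.NumberTheory.Irrationality.Fischler2002.JnPsiCellProofs
import HarnessLib

/-!
# Fischler 2002 §3: the involution `ψ` of the `n`-fold family `𝒥(p)` — `𝒥(ψ(p)) = 𝒥(p)` PROVED for every `n ≥ 2`

Topic `Literature/NumberTheory/Irrationality/Fischler2002`; proofs-only companion of `RhinViolaGroupsGeneral.lean`, whose NAMED
FACT `Jn_psi` is DISCHARGED here as `Jn_psi_holds` (second of two files; the change of variables is in `JnPsiCellProofs.lean`).
Cell `pub-zeta5`, seat ct-1 g30, 2026-08-27. Source: S. Fischler, « Formes linéaires en polyzêtas et intégrales multiples »,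
C. R. Acad. Sci. Paris Sér. I **335** (2002) 1–4 = arXiv:math/0202064 [Fischler2002Polyzetas], §3 p. 3: "Notons `ψ` celui qui à
`p` associe `p′` défini par : `a′_k = a_{n+1−k}` pour `1 ≤ k ≤ n`, `b′_k = b_{n+2−k}` pour `2 ≤ k ≤ n` et
`b′₁ = a_{n−1} + b_n − c_n`, `c′_k = a_{n+2−k} + b_{n+2−k} + c_{n+1−k} − b_{n+1−k} − a_{n−k}` pour `2 ≤ k ≤ n−1`,
`c′_n = a₂ + b₂ − b₁`. Alors des changements de variables montrent qu'on a `𝒥(p) = 𝒥(σ(p)) = 𝒥(ψ(p))` pour tout `p`"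
(journal version: S. Fischler, *Groupes de Rhin-Viola et intégrales multiples*, J. Théor. Nombres Bordeaux **15** (2003) 479–534
[Fischler2003RhinViola], §4.2 Prop. 14 with Prop. 11).

HONEST FRAMING (cells pub-zeta5 / zeta5-irr): systematic search; no irrationality claim unless certified. An identity between
(possibly infinite) `n`-fold integrals of non-negative functions; not an irrationality statement; nothing about `ζ(5)`.

## The proof (no convergence hypothesis is used; the identity holds in `ℝ₊ ∪ {∞}`)
In the nested coordinates `u_k = δ_k(x)` of `JnPsiCellProofs.lean` (`x_k = (1−u_k)/u_{k−1}`, `1 − x_k = (u_{k−1}+u_k−1)/u_{k−1}`,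
`dx = du/∏_{k<n}u_k`) the integrand of `𝒥(p)` times the Jacobian weight is the LAURENT MONOMIAL DENSITY
`M_p(u) = ∏_{k=1}^n (1−u_k)^{a_k} · ∏_{k=2}^n (u_{k−1}+u_k−1)^{b_k} · ∏_{k=1}^n u_k^{e_k}`,
`e_k = [k=1]b₁ − [k+1≤n](a_{k+1}+b_{k+1}) − [k≥2]c_k − 1` (`density_deltaMap_mul_weight`, by induction on `n` with the
tree's `JnChi.integrandJ_snoc`: splitting off `x_n` replaces `p` by `p̃` with `c_m ↦ c_m + a_{m+1} + b_{m+1}`, resp.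
`b₁ ↦ b₁ − a₂ − b₂` when `m = 1`), so `𝒥(p) = ∫⁻_{cell} M_p(u) du` (`Jn_eq_lintegral_cell`); and under the coordinate reversal
`u_k ↦ u_{n+1−k}` one has `M_p(u ∘ rev) = M_{ψ(p)}(u)` IDENTICALLY (`density_rev`: the printed formulae for `ψ` are exactly the
exponent bookkeeping `e_{n+1−k}(p) = e_k(ψ(p))`, `a_{n+1−k} = a′_k`, `b_{n+2−k} = b′_k`). The reversal invariance of the cell
(`JnPsi.lintegral_cell_rev`) concludes. To keep the file proofs-only the density is not given a name: the lemmas speak of any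
`M` satisfying the pointwise description `hM`. Theorems only, no definition, no new named fact (net debt −1).
-/

noncomputable section

namespace Literature.NumberTheory.Irrationality.Fischler2002

open MeasureTheory Set Finset
open scoped ENNReal

namespace JnPsi

open JnChi

/-! ### Reflection of products over `{a,…,n}` and the reversed point -/

/-- Reindexing `k ↦ n + a − k` of a product over `{a,…,n}`. [cite: Fischler2002Polyzetas, §3 p. 3 (definition of ψ)] -/
theorem prod_Icc_reflect {f g : ℕ → ℝ} {a n : ℕ} (h : ∀ k ∈ Finset.Icc a n, f k = g (n + a - k)) :
    ∏ k ∈ Finset.Icc a n, f k = ∏ k ∈ Finset.Icc a n, g k := by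
  refine Finset.prod_nbij' (fun k => n + a - k) (fun k => n + a - k) (fun k hk => ?_) (fun k hk => ?_)
    (fun k hk => ?_) (fun k hk => ?_) h
  all_goals simp only [Finset.mem_Icc] at hk ⊢; omega

/-- The 1-based coordinates of the reversed point: `(u ∘ rev)_k = u_{n+1−k}`. [cite: Fischler2002Polyzetas, §3 p. 3 (definition of ψ)] -/
theorem coord_rev {n : ℕ} (u : Fin n → ℝ) (k : ℕ) :
    coord (fun i : Fin n => u (Fin.rev i)) k = coord u (n + 1 - k) := by
  unfold coord
  by_cases hk : 1 ≤ k ∧ k ≤ n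
  · rw [dif_pos hk, dif_pos ⟨by omega, by omega⟩]
    show u (Fin.rev ⟨k - 1, _⟩) = u ⟨n + 1 - k - 1, _⟩
    congr 1
    ext
    simp only [Fin.val_rev]
    omega
  · rw [dif_neg hk, dif_neg (by omega)]

/-- The 1-based coordinates of the nested-coordinate point: `(δ(x))_k = δ_k(x)` for `1 ≤ k ≤ m`.
[cite: Fischler2002Polyzetas, §1 p. 2 (definition of δ_k)] -/
theorem coord_deltaMap {m : ℕ} (x : Fin m → ℝ) {k : ℕ} (hk : 1 ≤ k ∧ k ≤ m) :
    coord (fun i : Fin m => deltaV x (i.1 + 1)) k = deltaV x k := by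
  unfold coord
  rw [dif_pos hk]
  show deltaV x (k - 1 + 1) = deltaV x k
  rw [Nat.sub_add_cancel hk.1]

/-! ### The exponents of the Laurent monomial density: bookkeeping under `ψ` and under `x_n`-splitting -/

/-- **`e_{n+1−k}(p) = e_k(ψ(p))`** (written at the reflected index): the printed formulae for `ψ` are the exponent bookkeeping of
the density under reversal. [cite: Fischler2002Polyzetas, §3 p. 3 (definition of ψ)] -/
theorem exponent_psi {n : ℕ} (hn : 2 ≤ n) (p : Exponents) {k : ℕ} (hk : k ∈ Finset.Icc 1 n) :
    ((if k = 1 then p.b 1 else 0) - (if k + 1 ≤ n then p.a (k + 1) + p.b (k + 1) else 0) -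
        (if 2 ≤ k then p.c k else 0) - 1 : ℤ) =
      (if n + 1 - k = 1 then (psi n p).b 1 else 0) -
        (if n + 1 - k + 1 ≤ n then (psi n p).a (n + 1 - k + 1) + (psi n p).b (n + 1 - k + 1) else 0) -
        (if 2 ≤ n + 1 - k then (psi n p).c (n + 1 - k) else 0) - 1 := by
  rw [Finset.mem_Icc] at hk
  rcases (show k = n ∨ k = 1 ∨ (2 ≤ k ∧ k ≤ n - 1) by omega) with rfl | rfl | ⟨hk2, hkn⟩
  · -- `k = n`: both sides are `−c_n − 1`
    have e1 : k + 1 - k = 1 := by omega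
    have e2 : k + 1 - 2 = k - 1 := by omega
    have e3 : k + 2 - 2 = k := by omega
    simp only [show ¬ (k = 1) from by omega, show ¬ (k + 1 ≤ k) from by omega, show (2 ≤ k) from by omega, e1,
      show ¬ (2 ≤ 1) from by omega, if_true, if_false, psi, show (1 ≤ 1 + 1) from by omega,
      show ¬ (1 + 1 = 1) from by omega, show (2 ≤ 1 + 1) from by omega, and_self]
    rw [show 1 + 1 = 2 from rfl, e2, e3]
    ring
  · -- `k = 1`: both sides are `b₁ − a₂ − b₂ − 1`
    have e1 : n + 1 - 1 = n := by omega
    simp only [if_true, show (1 + 1 ≤ n) from by omega, show ¬ (2 ≤ 1) from by omega, if_false, e1,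
      show ¬ (n = 1) from by omega, show ¬ (n + 1 ≤ n) from by omega, psi, show ¬ (n ≤ n - 1) from by omega,
      and_false]
    ring
  · -- `2 ≤ k ≤ n − 1`: both sides are `−a_{k+1} − b_{k+1} − c_k − 1`
    have e1 : n + 1 - (n + 1 - k + 1) = k - 1 := by omega
    have e2 : n + 2 - (n + 1 - k + 1) = k := by omega
    have e3 : n + 2 - (n + 1 - k) = k + 1 := by omega
    have e4 : n + 1 - (n + 1 - k) = k := by omega
    have e5 : n - (n + 1 - k) = k - 1 := by omega
    simp only [show ¬ (k = 1) from by omega, show (k + 1 ≤ n) from by omega, show (2 ≤ k) from by omega,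
      show ¬ (n + 1 - k = 1) from by omega, show (n + 1 - k + 1 ≤ n) from by omega, show (2 ≤ n + 1 - k) from by omega,
      if_true, if_false, psi, show (1 ≤ n + 1 - k + 1) from by omega, show ¬ (n + 1 - k + 1 = 1) from by omega,
      show (2 ≤ n + 1 - k + 1) from by omega, show (n + 1 - k ≤ n - 1) from by omega, and_self, e1, e2, e3, e4, e5]
    ring

/-- **`e_k^{(m+1)}(p) = e_k^{(m)}(p̃)` for `k ≤ m`**, where `p̃` is `p` with `c_m ↦ c_m + a_{m+1} + b_{m+1}` (and, when `m = 1`,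
`b₁ ↦ b₁ − a₂ − b₂`): splitting off the last variable. [cite: Fischler2003RhinViola, §4.2 Proposition 14 (with Prop. 11)] -/
theorem exponent_snoc {m : ℕ} (hm : 1 ≤ m) (p : Exponents) {k : ℕ} (hk : k ∈ Finset.Icc 1 m) :
    ((if k = 1 then p.b 1 else 0) - (if k + 1 ≤ m + 1 then p.a (k + 1) + p.b (k + 1) else 0) -
        (if 2 ≤ k then p.c k else 0) - 1 : ℤ) =
      (if k = 1 then (if m = 1 ∧ 1 = 1 then p.b 1 - p.a 2 - p.b 2 else p.b 1) else 0) -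
        (if k + 1 ≤ m then
            p.a (k + 1) + (if m = 1 ∧ k + 1 = 1 then p.b 1 - p.a 2 - p.b 2 else p.b (k + 1)) else 0) -
        (if 2 ≤ k then (if k = m then p.c m + p.a (m + 1) + p.b (m + 1) else p.c k) else 0) - 1 := by
  rw [Finset.mem_Icc] at hk
  rcases lt_or_eq_of_le hk.2 with hlt | rfl
  · -- `k < m`
    simp only [show (k + 1 ≤ m + 1) from by omega, show (k + 1 ≤ m) from by omega, show ¬ (m = 1) from by omega,
      show ¬ (k = m) from by omega, if_true, if_false, false_and]
  · -- `k = m`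
    by_cases hk1 : k = 1
    · subst hk1
      simp only [if_true, le_refl, show ¬ (2 ≤ 1) from by omega, if_false, and_self]
      ring
    · simp only [hk1, if_false, le_refl, show (2 ≤ k) from by omega, show ¬ (k + 1 ≤ k) from by omega, if_true]
      ring

/-! ### The Laurent monomial density `M_p` (any `M` satisfying `hM`) -/

/-- The density is a measurable function of `u`. [cite: Fischler2003RhinViola, §4.2 Proposition 14 (with Prop. 11)] -/
theorem measurable_density (M : (n : ℕ) → Exponents → (Fin n → ℝ) → ℝ)
    (hM : ∀ (n : ℕ) (p : Exponents) (u : Fin n → ℝ), M n p u =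
      (∏ k ∈ Finset.Icc 1 n, (1 - coord u k) ^ p.a k) * (∏ k ∈ Finset.Icc 2 n, (coord u (k - 1) + coord u k - 1) ^ p.b k) *
        ∏ k ∈ Finset.Icc 1 n, coord u k ^ ((if k = 1 then p.b 1 else 0) -
          (if k + 1 ≤ n then p.a (k + 1) + p.b (k + 1) else 0) - (if 2 ≤ k then p.c k else 0) - 1))
    (n : ℕ) (p : Exponents) : Measurable fun u : Fin n → ℝ => ENNReal.ofReal (M n p u) := by
  have h : M n p = fun u =>
      (∏ k ∈ Finset.Icc 1 n, (1 - coord u k) ^ p.a k) * (∏ k ∈ Finset.Icc 2 n, (coord u (k - 1) + coord u k - 1) ^ p.b k) *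
        ∏ k ∈ Finset.Icc 1 n, coord u k ^ ((if k = 1 then p.b 1 else 0) -
          (if k + 1 ≤ n then p.a (k + 1) + p.b (k + 1) else 0) - (if 2 ≤ k then p.c k else 0) - 1) :=
    funext fun u => hM n p u
  refine Measurable.ennreal_ofReal ?_
  rw [h]
  refine ((Finset.measurable_prod _ fun k _ => ?_).mul (Finset.measurable_prod _ fun k _ => ?_)).mul
    (Finset.measurable_prod _ fun k _ => ?_)
  · exact (measurable_const.sub (measurable_coord k)).pow_const _
  · exact (((measurable_coord (k - 1)).add (measurable_coord k)).sub measurable_const).pow_const _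
  · exact (measurable_coord k).pow_const _

/-- **`M_p(u ∘ rev) = M_{ψ(p)}(u)` identically** (`n ≥ 2`): reflect each of the three products (`k ↦ n+1−k`, resp.
`k ↦ n+2−k`) and use `a′_k = a_{n+1−k}`, `b′_k = b_{n+2−k}`, `e_k(ψp) = e_{n+1−k}(p)`.
[cite: Fischler2002Polyzetas, §3 p. 3 (definition of ψ; 𝒥(p) = 𝒥(ψ(p)))] -/
theorem density_rev (M : (n : ℕ) → Exponents → (Fin n → ℝ) → ℝ)
    (hM : ∀ (n : ℕ) (p : Exponents) (u : Fin n → ℝ), M n p u =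
      (∏ k ∈ Finset.Icc 1 n, (1 - coord u k) ^ p.a k) * (∏ k ∈ Finset.Icc 2 n, (coord u (k - 1) + coord u k - 1) ^ p.b k) *
        ∏ k ∈ Finset.Icc 1 n, coord u k ^ ((if k = 1 then p.b 1 else 0) -
          (if k + 1 ≤ n then p.a (k + 1) + p.b (k + 1) else 0) - (if 2 ≤ k then p.c k else 0) - 1))
    {n : ℕ} (hn : 2 ≤ n) (p : Exponents) (u : Fin n → ℝ) :
    M n p (fun i => u (Fin.rev i)) = M n (psi n p) u := by
  rw [hM, hM]
  simp only [coord_rev u]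
  have hA : ∏ k ∈ Finset.Icc 1 n, (1 - coord u (n + 1 - k)) ^ p.a k = ∏ k ∈ Finset.Icc 1 n, (1 - coord u k) ^ (psi n p).a k := by
    refine prod_Icc_reflect fun k hk => ?_
    rw [Finset.mem_Icc] at hk
    have e1 : n + 1 - (n + 1 - k) = k := by omega
    simp only [psi, show (1 ≤ n + 1 - k) from by omega, show (n + 1 - k ≤ n) from by omega, and_self, if_true, e1]
  have hB : ∏ k ∈ Finset.Icc 2 n, (coord u (n + 1 - (k - 1)) + coord u (n + 1 - k) - 1) ^ p.b k =
      ∏ k ∈ Finset.Icc 2 n, (coord u (k - 1) + coord u k - 1) ^ (psi n p).b k := by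
    refine prod_Icc_reflect fun k hk => ?_
    rw [Finset.mem_Icc] at hk
    have e1 : n + 2 - k - 1 = n + 1 - k := by omega
    have e2 : n + 1 - (k - 1) = n + 2 - k := by omega
    have e3 : n + 2 - (n + 2 - k) = k := by omega
    simp only [psi, show ¬ (n + 2 - k = 1) from by omega, show (2 ≤ n + 2 - k) from by omega,
      show (n + 2 - k ≤ n) from by omega, and_self, if_true, if_false, e1, e2, e3, add_comm (coord u (n + 1 - k))]
  have hE : ∏ k ∈ Finset.Icc 1 n, coord u (n + 1 - k) ^ ((if k = 1 then p.b 1 else 0) -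
        (if k + 1 ≤ n then p.a (k + 1) + p.b (k + 1) else 0) - (if 2 ≤ k then p.c k else 0) - 1) =
      ∏ k ∈ Finset.Icc 1 n, coord u k ^ ((if k = 1 then (psi n p).b 1 else 0) -
        (if k + 1 ≤ n then (psi n p).a (k + 1) + (psi n p).b (k + 1) else 0) -
        (if 2 ≤ k then (psi n p).c k else 0) - 1) := by
    refine prod_Icc_reflect fun k hk => ?_
    rw [exponent_psi hn p hk]
  rw [hA, hB, hE]

/-- **Splitting off the last variable in the density**: for `m ≥ 1`,
`M^{(m+1)}_p(u′, s) = M^{(m)}_{p̃}(u′) · (1−s)^{a_{m+1}} (u′_m + s − 1)^{b_{m+1}} s^{−c_{m+1}−1}` with `p̃` as in `exponent_snoc`.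
[cite: Fischler2003RhinViola, §4.2 Proposition 14 (with Prop. 11)] -/
theorem density_snoc (M : (n : ℕ) → Exponents → (Fin n → ℝ) → ℝ)
    (hM : ∀ (n : ℕ) (p : Exponents) (u : Fin n → ℝ), M n p u =
      (∏ k ∈ Finset.Icc 1 n, (1 - coord u k) ^ p.a k) * (∏ k ∈ Finset.Icc 2 n, (coord u (k - 1) + coord u k - 1) ^ p.b k) *
        ∏ k ∈ Finset.Icc 1 n, coord u k ^ ((if k = 1 then p.b 1 else 0) -
          (if k + 1 ≤ n then p.a (k + 1) + p.b (k + 1) else 0) - (if 2 ≤ k then p.c k else 0) - 1))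
    {m : ℕ} (hm : 1 ≤ m) (p : Exponents) (u' : Fin m → ℝ) (s : ℝ) :
    M (m + 1) p (Fin.snoc u' s) =
      M m ⟨p.a, fun k => if m = 1 ∧ k = 1 then p.b 1 - p.a 2 - p.b 2 else p.b k,
          fun k => if k = m then p.c m + p.a (m + 1) + p.b (m + 1) else p.c k⟩ u' *
        ((1 - s) ^ p.a (m + 1) * (coord u' m + s - 1) ^ p.b (m + 1) * s ^ (-(p.c (m + 1)) - 1)) := by
  rw [hM, hM]
  dsimp only
  rw [Finset.prod_Icc_succ_top (by omega : 1 ≤ m + 1), Finset.prod_Icc_succ_top (by omega : 2 ≤ m + 1),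
    Finset.prod_Icc_succ_top (by omega : 1 ≤ m + 1), coord_snoc_last, Nat.add_sub_cancel,
    coord_snoc_of_le u' s le_rfl]
  have hA : ∏ k ∈ Finset.Icc 1 m, (1 - coord (Fin.snoc u' s : Fin (m + 1) → ℝ) k) ^ p.a k =
      ∏ k ∈ Finset.Icc 1 m, (1 - coord u' k) ^ p.a k :=
    Finset.prod_congr rfl fun k hk => by rw [coord_snoc_of_le u' s (Finset.mem_Icc.1 hk).2]
  have hB : ∏ k ∈ Finset.Icc 2 m, (coord (Fin.snoc u' s : Fin (m + 1) → ℝ) (k - 1) +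
        coord (Fin.snoc u' s : Fin (m + 1) → ℝ) k - 1) ^ p.b k =
      ∏ k ∈ Finset.Icc 2 m, (coord u' (k - 1) + coord u' k - 1) ^ (if m = 1 ∧ k = 1 then p.b 1 - p.a 2 - p.b 2 else p.b k) :=
    Finset.prod_congr rfl fun k hk => by
      have hk' := Finset.mem_Icc.1 hk
      rw [coord_snoc_of_le u' s (by omega : k - 1 ≤ m), coord_snoc_of_le u' s hk'.2,
        if_neg (by omega : ¬ (m = 1 ∧ k = 1))]
  have hE : ∏ k ∈ Finset.Icc 1 m, coord (Fin.snoc u' s : Fin (m + 1) → ℝ) k ^ ((if k = 1 then p.b 1 else 0) -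
        (if k + 1 ≤ m + 1 then p.a (k + 1) + p.b (k + 1) else 0) - (if 2 ≤ k then p.c k else 0) - 1) =
      ∏ k ∈ Finset.Icc 1 m, coord u' k ^ ((if k = 1 then (if m = 1 ∧ 1 = 1 then p.b 1 - p.a 2 - p.b 2 else p.b 1) else 0) -
        (if k + 1 ≤ m then
            p.a (k + 1) + (if m = 1 ∧ k + 1 = 1 then p.b 1 - p.a 2 - p.b 2 else p.b (k + 1)) else 0) -
        (if 2 ≤ k then (if k = m then p.c m + p.a (m + 1) + p.b (m + 1) else p.c k) else 0) - 1) :=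
    Finset.prod_congr rfl fun k hk => by
      rw [coord_snoc_of_le u' s (Finset.mem_Icc.1 hk).2, exponent_snoc hm p hk]
  have htop : ((if m + 1 = 1 then p.b 1 else 0) - (if m + 1 + 1 ≤ m + 1 then p.a (m + 1 + 1) + p.b (m + 1 + 1) else 0) -
      (if 2 ≤ m + 1 then p.c (m + 1) else 0) - 1 : ℤ) = -(p.c (m + 1)) - 1 := by
    simp only [show ¬ (m + 1 = 1) from by omega, show ¬ (m + 1 + 1 ≤ m + 1) from by omega, show (2 ≤ m + 1) from by omega,
      if_true, if_false]
    ring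
  rw [hA, hB, hE, htop]
  ring

/-- **`𝒥`'s integrand with the modified parameters `p̃`**: for `m ≥ 1` and `x′ ∈ (0,1)^m`,
`integrand^{(m)}(p̃)(x′) = [∏_{k≤m} x_k^{a_k}(1−x_k)^{b_k} / ∏_{2≤k≤m} δ_k^{c_k}] · δ_m^{−(a_{m+1}+b_{m+1})}/δ_m`.
[cite: Fischler2003RhinViola, §4.2 Proposition 14 (with Prop. 11)] -/
theorem integrandJ_tilde {m : ℕ} (hm : 1 ≤ m) (p : Exponents) {x : Fin m → ℝ} (hx : ∀ i, 0 < x i ∧ x i < 1) :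
    integrandJ m ⟨p.a, fun k => if m = 1 ∧ k = 1 then p.b 1 - p.a 2 - p.b 2 else p.b k,
        fun k => if k = m then p.c m + p.a (m + 1) + p.b (m + 1) else p.c k⟩ x =
      (∏ k ∈ Finset.Icc 1 m, coord x k ^ p.a k * (1 - coord x k) ^ p.b k) / (∏ k ∈ Finset.Icc 2 m, deltaV x k ^ p.c k) *
        (deltaV x m ^ (-(p.a (m + 1) + p.b (m + 1))) / deltaV x m) := by
  have hδ : deltaV x m ≠ 0 := (deltaV_mem hx m le_rfl).1.ne'
  unfold integrandJ
  dsimp only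
  rcases eq_or_lt_of_le hm with h1 | h2
  · -- `m = 1`
    subst h1
    have hc1 : 1 - coord x 1 ≠ 0 := by
      have : coord x 1 < 1 := by
        unfold coord
        rw [dif_pos ⟨le_rfl, le_rfl⟩]
        exact (hx _).2
      linarith
    have hI : (Finset.Icc 2 1 : Finset ℕ) = ∅ := by decide
    simp only [Finset.Icc_self, Finset.prod_singleton, hI, Finset.prod_empty, and_self, if_true, div_one]
    have hδ1 : deltaV x 1 = 1 - coord x 1 := by
      show 1 - coord x 1 * 1 = 1 - coord x 1
      rw [mul_one]
    rw [hδ1, show p.b 1 - p.a 2 - p.b 2 = p.b 1 + (-(p.a (1 + 1) + p.b (1 + 1))) by ring, zpow_add₀ hc1]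
    ring
  · -- `m ≥ 2`
    obtain ⟨m', rfl⟩ : ∃ m', m = m' + 1 := ⟨m - 1, by omega⟩
    have hm' : 1 ≤ m' := by omega
    have hN : ∏ k ∈ Finset.Icc 1 (m' + 1), coord x k ^ p.a k *
          (1 - coord x k) ^ (if m' + 1 = 1 ∧ k = 1 then p.b 1 - p.a 2 - p.b 2 else p.b k) =
        ∏ k ∈ Finset.Icc 1 (m' + 1), coord x k ^ p.a k * (1 - coord x k) ^ p.b k :=
      Finset.prod_congr rfl fun k hk => by rw [if_neg (by omega : ¬ (m' + 1 = 1 ∧ k = 1))]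
    have hD : ∏ k ∈ Finset.Icc 2 (m' + 1), deltaV x k ^ (if k = m' + 1 then p.c (m' + 1) + p.a (m' + 1 + 1) + p.b (m' + 1 + 1)
          else p.c k) =
        (∏ k ∈ Finset.Icc 2 (m' + 1), deltaV x k ^ p.c k) * deltaV x (m' + 1) ^ (p.a (m' + 1 + 1) + p.b (m' + 1 + 1)) := by
      rw [Finset.prod_Icc_succ_top (by omega : 2 ≤ m' + 1), Finset.prod_Icc_succ_top (by omega : 2 ≤ m' + 1), if_pos rfl,
        show p.c (m' + 1) + p.a (m' + 1 + 1) + p.b (m' + 1 + 1) = p.c (m' + 1) + (p.a (m' + 1 + 1) + p.b (m' + 1 + 1)) by ring,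
        zpow_add₀ hδ, mul_assoc]
      congr 1
      exact Finset.prod_congr rfl fun k hk => by
        rw [if_neg (by have := (Finset.mem_Icc.1 hk).2; omega : ¬ (k = m' + 1))]
    rw [hN, hD, zpow_neg]
    have hz : deltaV x (m' + 1) ^ (p.a (m' + 1 + 1) + p.b (m' + 1 + 1)) ≠ 0 := zpow_ne_zero _ hδ
    field_simp

/-- The one-variable algebra of the induction step: with `s = 1 − tδ`,
`δ^{−(a+b)}/δ · (1−s)^a (δ+s−1)^b s^{−c−1} · δ = t^a(1−t)^b/((1−tδ)^c(1−tδ))`. [cite: Fischler2003RhinViola, §4.2 Proposition 14 (with Prop. 11)] -/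
theorem step_algebra {δ t : ℝ} (hδ : δ ≠ 0) (hw : 1 - t * δ ≠ 0) (a b c : ℤ) :
    δ ^ (-(a + b)) / δ * ((1 - (1 - t * δ)) ^ a * (δ + (1 - t * δ) - 1) ^ b * (1 - t * δ) ^ (-c - 1) * δ) =
      t ^ a * (1 - t) ^ b / ((1 - t * δ) ^ c * (1 - t * δ)) := by
  have e1 : (1 : ℝ) - (1 - t * δ) = t * δ := by ring
  have e2 : δ + (1 - t * δ) - 1 = (1 - t) * δ := by ring
  have e3 : (-c - 1 : ℤ) = -(c + 1) := by ring
  rw [e1, e2, e3, mul_zpow, mul_zpow, zpow_neg, zpow_neg, zpow_add₀ hδ, zpow_add_one₀ hw]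
  have hδa : δ ^ a ≠ 0 := zpow_ne_zero a hδ
  have hδb : δ ^ b ≠ 0 := zpow_ne_zero b hδ
  have hwc : (1 - t * δ) ^ c ≠ 0 := zpow_ne_zero c hw
  field_simp

/-- **The density in the nested coordinates is the integrand of `𝒥(p)`**: for `n ≥ 1` and `x ∈ (0,1)^n`,
`M_p(δ(x)) · ∏_{k<n} δ_k(x) = integrand(p)(x)` (`x_k = (1−u_k)/u_{k−1}`, `1 − x_k = (u_{k−1}+u_k−1)/u_{k−1}`, Jacobian weight
`∏_{k<n} δ_k`). By induction on `n`, splitting off the last variable (`JnChi.integrandJ_snoc`, `density_snoc`).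
[cite: Fischler2003RhinViola, §4.2 Proposition 14 (with Prop. 11)] [cite: Fischler2002Polyzetas, §3 p. 3 (𝒥(p) = 𝒥(ψ(p)))] -/
theorem density_deltaMap_mul_weight (M : (n : ℕ) → Exponents → (Fin n → ℝ) → ℝ)
    (hM : ∀ (n : ℕ) (p : Exponents) (u : Fin n → ℝ), M n p u =
      (∏ k ∈ Finset.Icc 1 n, (1 - coord u k) ^ p.a k) * (∏ k ∈ Finset.Icc 2 n, (coord u (k - 1) + coord u k - 1) ^ p.b k) *
        ∏ k ∈ Finset.Icc 1 n, coord u k ^ ((if k = 1 then p.b 1 else 0) -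
          (if k + 1 ≤ n then p.a (k + 1) + p.b (k + 1) else 0) - (if 2 ≤ k then p.c k else 0) - 1))
    {n : ℕ} (hn : 1 ≤ n) (p : Exponents) {x : Fin n → ℝ} (hx : ∀ i, 0 < x i ∧ x i < 1) :
    M n p (fun i => deltaV x (i.1 + 1)) * ∏ k ∈ Finset.range n, deltaV x k = integrandJ n p x := by
  induction n, hn using Nat.le_induction generalizing p with
  | base =>
    have hc : 0 < coord x 1 ∧ coord x 1 < 1 := by
      unfold coord
      rw [dif_pos ⟨le_rfl, le_rfl⟩]
      exact hx _
    have hc1 : 1 - coord x 1 ≠ 0 := by linarith [hc.2]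
    have hI : (Finset.Icc 2 1 : Finset ℕ) = ∅ := by decide
    have hδ1 : deltaV x 1 = 1 - coord x 1 := by
      show 1 - coord x 1 * 1 = 1 - coord x 1
      rw [mul_one]
    rw [hM]
    unfold integrandJ
    simp only [Finset.Icc_self, Finset.prod_singleton, hI, Finset.prod_empty, Finset.range_one, div_one]
    rw [coord_deltaMap x ⟨le_rfl, le_rfl⟩]
    simp only [if_true, show ¬ (1 + 1 ≤ 1) from by omega, if_false, sub_zero, mul_one]
    rw [hδ1, sub_sub_cancel, show deltaV x 0 = 1 from rfl, mul_one, zpow_sub_one₀ hc1]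
    ring
  | succ m hm ih =>
    obtain ⟨x', t, rfl⟩ : ∃ (x' : Fin m → ℝ) (t : ℝ), x = Fin.snoc x' t :=
      ⟨Fin.init x, x (Fin.last m), (Fin.snoc_init_self x).symm⟩
    have hx' : ∀ i, 0 < x' i ∧ x' i < 1 := fun i => by simpa [Fin.snoc_castSucc] using hx (Fin.castSucc i)
    have ht : 0 < t ∧ t < 1 := by simpa [Fin.snoc_last] using hx (Fin.last m)
    have hδ := deltaV_mem hx' m le_rfl
    have hδne : deltaV x' m ≠ 0 := hδ.1.ne'
    have hw : 1 - t * deltaV x' m ≠ 0 := by nlinarith [mul_lt_mul'' ht.2 (lt_of_le_of_lt hδ.2.1 (lt_add_one (1:ℝ))) ht.1.le hδ.1.le]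
    have IH := ih ⟨p.a, fun k => if m = 1 ∧ k = 1 then p.b 1 - p.a 2 - p.b 2 else p.b k,
      fun k => if k = m then p.c m + p.a (m + 1) + p.b (m + 1) else p.c k⟩ hx'
    rw [integrandJ_tilde hm p hx'] at IH
    rw [deltaMap_snoc, prod_deltaV_snoc, Finset.prod_range_succ, density_snoc M hM hm, coord_deltaMap x' ⟨hm, le_rfl⟩,
      integrandJ_snoc hm]
    have hre : ∀ (A B C D : ℝ), A * B * (C * D) = A * C * (B * D) := fun A B C D => by ring
    rw [hre, IH, mul_assoc, step_algebra hδne hw]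

/-- **`𝒥(p) = ∫⁻_{cell} M_p(u) du`** for every `n ≥ 1` and every `p` (in `ℝ₊ ∪ {∞}`): the substitution theorem
`JnPsi.lintegral_cell_eq_lintegral_cube` and `density_deltaMap_mul_weight` (`[0,1]^n = (0,1)^n` a.e.).
[cite: Fischler2003RhinViola, §4.2 Proposition 14 (with Prop. 11)] [cite: Fischler2002Polyzetas, §3 p. 3 (𝒥(p) = 𝒥(ψ(p)))] -/
theorem Jn_eq_lintegral_cell (M : (n : ℕ) → Exponents → (Fin n → ℝ) → ℝ)
    (hM : ∀ (n : ℕ) (p : Exponents) (u : Fin n → ℝ), M n p u =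
      (∏ k ∈ Finset.Icc 1 n, (1 - coord u k) ^ p.a k) * (∏ k ∈ Finset.Icc 2 n, (coord u (k - 1) + coord u k - 1) ^ p.b k) *
        ∏ k ∈ Finset.Icc 1 n, coord u k ^ ((if k = 1 then p.b 1 else 0) -
          (if k + 1 ≤ n then p.a (k + 1) + p.b (k + 1) else 0) - (if 2 ≤ k then p.c k else 0) - 1))
    {n : ℕ} (hn : 1 ≤ n) (p : Exponents) :
    Jn n p = ∫⁻ u in {u : Fin n → ℝ | (∀ i, 0 < u i ∧ u i < 1) ∧ ∀ i j : Fin n, j.1 = i.1 + 1 → 1 < u i + u j},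
      ENNReal.ofReal (M n p u) := by
  rw [lintegral_cell_eq_lintegral_cube n _ (measurable_density M hM n p)]
  unfold Jn
  rw [← setLIntegral_congr (openCube_ae_eq_unitCube n)]
  refine setLIntegral_congr_fun (measurableSet_openCube n) fun x hx' => ?_
  have hx : ∀ i, 0 < x i ∧ x i < 1 := fun i => hx' i (Set.mem_univ _)
  rw [← density_deltaMap_mul_weight M hM hn p hx, mul_comm (M n p _),
    ENNReal.ofReal_mul (prod_deltaV_pos hx (Nat.le_succ n)).le, mul_comm]

end JnPsi

open JnPsi in
/-- **Fischler's involution `ψ` preserves `𝒥` — PROVED** (the named fact `Jn_psi` of `RhinViolaGroupsGeneral.lean` is a theorem):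
for every `n ≥ 2` and every `p ∈ ℤ^{3n−1}`, `𝒥(ψ(p)) = 𝒥(p)` in `ℝ₊ ∪ {∞}` (no convergence hypothesis). Route: the nested
coordinates `u_k = δ_k(x)` map `(0,1)^n` onto the zigzag cell `{u_{k−1}+u_k > 1}` with `dx = du/∏_{k<n}u_k`
(`JnPsi.lintegral_cell_eq_lintegral_cube`, by induction on `n` — iterated one-dimensional substitutions, no `n×n` Jacobian),
the integrand becomes the Laurent monomial density `M_p` (`JnPsi.density_deltaMap_mul_weight`), the cell and its volume are
invariant under `u_k ↦ u_{n+1−k}` (`JnPsi.lintegral_cell_rev`), and `M_p(u ∘ rev) = M_{ψ(p)}(u)` (`JnPsi.density_rev`).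
[cite: Fischler2002Polyzetas, §3 p. 3 (𝒥(p) = 𝒥(ψ(p)))] [cite: Fischler2003RhinViola, §4.2 Proposition 14 (with Prop. 11)] -/
theorem Jn_psi_holds : Jn_psi := by
  intro n p hn
  obtain ⟨M, hM⟩ : ∃ M : (n : ℕ) → Exponents → (Fin n → ℝ) → ℝ, ∀ (n : ℕ) (p : Exponents) (u : Fin n → ℝ), M n p u =
      (∏ k ∈ Finset.Icc 1 n, (1 - coord u k) ^ p.a k) * (∏ k ∈ Finset.Icc 2 n, (coord u (k - 1) + coord u k - 1) ^ p.b k) *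
        ∏ k ∈ Finset.Icc 1 n, coord u k ^ ((if k = 1 then p.b 1 else 0) -
          (if k + 1 ≤ n then p.a (k + 1) + p.b (k + 1) else 0) - (if 2 ≤ k then p.c k else 0) - 1) :=
    ⟨fun n p u => _, fun _ _ _ => rfl⟩
  rw [Jn_eq_lintegral_cell M hM (by omega) (psi n p), Jn_eq_lintegral_cell M hM (by omega) p,
    lintegral_cell_rev n (fun u => ENNReal.ofReal (M n p u))]
  refine lintegral_congr fun u => ?_
  rw [density_rev M hM hn p u]

end Literature.NumberTheory.Irrationality.Fischler2002

end
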